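import Literature.AlgebraicGeometry.Frobenioids.UnitTrivializationProp48iiiUnconditional
import Literature.AlgebraicGeometry.Frobenioids.UnitTrivializationSquareSlim
import Literature.AlgebraicGeometry.Frobenioids.Prop55Sub
import HarnessLib

/-!
# Frobenioids I, Proposition 4.8 (iii) — FACT-LIST F-1050 `PreFrobenioidData.Prop48iii`: the direct-head
# instance AT THE DATA (proof-only)

Mochizuki, *The geometry of Frobenioids I: the general theory*, Kyushu J. Math. **62** (2008) 293–400, §4,
Proposition 4.8 (iii), kurims text p. 88: "If `C` is of rationally standard type, then `(C^istr)^birat` is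
of standard type." [cite: MochizukiFrdI2008, Prop. 4.8 (iii) p.88]

PROOF-ONLY companion (abc-iut cell, block F, KEY row INST59D, seat abc-iut-f-055; 0 `def` / `structure` /
`instance`, no `Prop` fact) of abc-iut-L1-t3's `DivisorMonoidCategoryTheoreticityDefs.lean`, where the
proposition is typed over the §3–§4 statement INTERFACE as the schema
`Prop48iii S R SI BI := S.IsOfRationallyStandardType R → BI.ops.IsOfStandardType` with the operations `SI`
on `C^istr` and the birationalization datum `BI` of `C^istr` as FREE parameters.  State of the row in the
tree: universal closure REFUTED (abc-iut-f-025's `PreFrobenioidData.not_forall_prop48iii`, junk `(SI, BI)`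
over the arithmetic Frobenioid `C_{ℚ/ℚ}`, `Prop48iiiSchemaNegative.lean`); the printed proposition PROVED
for every Frobenioid AT THE DATA by abc-iut-L1-d5 (`PreFrobenioidData.prop48iii_rationallyStandard'`,
`UnitTrivializationProp48iiiUnconditional.lean`) — but with its conclusion UNFOLDED
(`(ofFunctor 0_D ((C^istr)^birat → F_{0_D})).IsOfStandardType` over found's rendering `PreFrobenioid.Istr F`
of `C^istr`), so that the L-F kernel census (plan/LF-KERNEL-STATUS.tsv, 2026-08-27, col 14: «closure
REFUTERS 1», col 11: «prop48iii_of_frobeniusCompact [∅name]») found NO theorem whose conclusion head is the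
frozen `PreFrobenioidData.Prop48iii`.

This file closes that gap with NO new definition: `PreFrobenioidData.prop48iii_ofFunctor` concludes
LITERALLY in `Prop48iii S R SI BI` at
* `S  := ofFunctor Φ F` — the operations of a Frobenioid `F : C → F_Φ` (abc-iut-L1's adapter);
* `R  := PreFrobenioid.rsParams hF Supp` — THE Def. 4.5 (iii) parameters (abc-iut-L1-d5, `Prop55Sub.lean`:
  THE birationalization of `C`, the operations of `C^un-tr`, THE birationalization of `C^un-tr`; only the §2
  support predicate `Supp` is a parameter);
* `SI := ofFunctor Φ ((ofFunctor Φ F).istrι ⋙ F)` — THE restriction of `C → F_Φ` to the interface's own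
  `C^istr = (ofFunctor Φ F).Istr` (Prop. 1.9 (v): a Frobenioid, `PreFrobenioid.isFrobenioid_istrι_comp`, transported
  from abc-iut-L1-t1's `isFrobenioid_istr` along abc-iut-L1-d6's `isotropicObjects_ofFunctor` — the two
  renderings of `C^istr` are cut out by propositionally equal object properties);
* `BI := PreFrobenioid.biratData …` — THE birationalization `(C^istr)^birat → F_{0_D}` of that Frobenioid
  ([FrdI] Prop. 4.4, abc-iut-L1-d5's `BirationalizationBiratData.lean`), square-completeness discharged by
  abc-iut-L6-t6's `hasBiratSquares_of_isFrobenioid`;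
and is PROVED by transporting `prop48iii_rationallyStandard'` along `isotropicObjects_ofFunctor`.  So the
row F-1050 now reads: closure REFUTED (junk parameters) · instance AT THE DATA PROVED with conclusion head
the frozen decl (R5: the only admissible instance).  HONEST FRAMING: [FrdI] is refereed, undisputed
mathematics; nothing here is specific to the abc programme or bears on [IUTchIII] Cor. 3.12.
-/

namespace Literature.AlgebraicGeometry.Frobenioids

open CategoryTheory Opposite

universe w v v' u u'

namespace PreFrobenioid

variable {D : Type u} [Category.{v} D] {Φ : Dᵒᵖ ⥤ CommMonCat.{w}} {C : Type u'} [Category.{v'} C]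
  {F : C ⥤ ElemFrobenioid Φ}

/-- **[FrdI] Prop. 1.9 (v) for the §3–§4 rendering of `C^istr`.**  The restriction of a Frobenioid
`C → F_Φ` to the interface's full subcategory `(ofFunctor Φ F).Istr` of isotropic objects is a Frobenioid —
abc-iut-L1-t1's `isFrobenioid_istr` transported along `isotropicObjects_ofFunctor` (the data-level and the
functor-level classes of isotropic objects coincide). [cite: MochizukiFrdI2008, Prop. 1.9(v) p.32] -/
theorem isFrobenioid_istrι_comp (hF : IsFrobenioid F) :
    IsFrobenioid ((PreFrobenioidData.ofFunctor Φ F).istrι ⋙ F) := by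
  change IsFrobenioid ((PreFrobenioidData.ofFunctor Φ F).isotropicObjects.ι ⋙ F)
  rw [isotropicObjects_ofFunctor]
  exact isFrobenioid_istr hF

end PreFrobenioid

namespace PreFrobenioidData

variable {D : Type u} [Category.{v} D] {Φ : Dᵒᵖ ⥤ CommMonCat.{w}} {C : Type u'} [Category.{v'} C]
  {F : C ⥤ ElemFrobenioid Φ}

/-- **[FrdI] Proposition 4.8 (iii) AT THE DATA, conclusion head the frozen schema `Prop48iii`** (FACT-LIST
F-1050, R5 instance): for every Frobenioid `F : C → F_Φ` and every §2 support predicate `Supp`, the typed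
`Prop48iii` holds at `S = ofFunctor Φ F`, THE Def. 4.5 (iii) parameters `PreFrobenioid.rsParams hF Supp`, THE
restricted operations of `C^istr → F_Φ` on the interface's `C^istr`, and THE birationalization
`(C^istr)^birat → F_{0_D}` of that Frobenioid: "if `C` is of rationally standard type, then `(C^istr)^birat`
is of standard type" — abc-iut-L1-d5's `prop48iii_rationallyStandard'` transported along
`isotropicObjects_ofFunctor`. [cite: MochizukiFrdI2008, Prop. 4.8 (iii) p.88] -/
theorem prop48iii_ofFunctor (hF : PreFrobenioid.IsFrobenioid F)
    (Supp : ∀ {X : D}, (ofFunctor Φ F).Mon X → Primes ((ofFunctor Φ F).Mon X) → Prop) :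
    Literature.AlgebraicGeometry.Frobenioids.PreFrobenioidData.Prop48iii (ofFunctor Φ F)
      (PreFrobenioid.rsParams hF Supp) (ofFunctor Φ ((ofFunctor Φ F).istrι ⋙ F))
      (PreFrobenioid.biratData (PreFrobenioid.isFrobenioid_istrι_comp hF)
        (PreFrobenioid.hasBiratSquares_of_isFrobenioid (PreFrobenioid.isFrobenioid_istrι_comp hF))) := by
  intro hR
  -- reduce to found's rendering `istrFunctor F = (isotropicObjects F).ι ⋙ F` of `C^istr → F_Φ`
  suffices key : ∀ (P : ObjectProperty C) (_ : P = PreFrobenioid.isotropicObjects F)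
      (hI : PreFrobenioid.IsFrobenioid (P.ι ⋙ F)),
      (ofFunctor (zeroMonoid D) (PreFrobenioid.Birat.toElemZero hI
        (PreFrobenioid.hasBiratSquares_of_isFrobenioid hI))).IsOfStandardType from
    key _ PreFrobenioid.isotropicObjects_ofFunctor _
  rintro P rfl hI
  exact prop48iii_rationallyStandard' hF Supp hR

end PreFrobenioidData

end Literature.AlgebraicGeometry.Frobenioids
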